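import Summits.AtomisticToContinuum.Crystallization.Theorems.OverbindingBudgetLocalRelaxationCut

/-!
# OverbindingBudget — the local relaxation test, II: dense improving surgeries strain the cubes (lens-4 g28)

`surgerySuperposition_holds : SurgerySuperposition` — a uniformly dense family of improving surgeries (gain `g`, radius `R`, density `G`)
in a `δ`-separated texture gives `StrainedCubes κ` with `κ = g / (2D³)`, `D = 2(G+R+H)`, buffer `H = max(R, 1, 2K/g)`,
`K = 864 M₀ (δ⁻⁶+1) δ⁻³ + 216 M₀²`, `M₀ = (2(2R+1)/δ+1)³`: in the cube `[0, nD)³` the `n³` cell-centred patches are disjoint, `≥ 2(R+H)`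
apart and `≥ H` from the exterior; exterior tails `≤ 432(δ⁻⁶+1)δ⁻³H⁻³` and cross rows `≤ 16 M₀ d⁻⁶` (summed dyadically) fit in `g/2`
per cell (`superpose_estimate` of part I).  Corollary `localRelaxationTest_of_recurrence`: LRT ⟸ `ImprovementRecurrence` alone.
-/

noncomputable section

open Metric Set
open scoped BigOperators
open Literature.MathematicalPhysics.StatisticalMechanics
open Summit.AtomisticToContinuum.Crystallization.Theorems.OverbindingBudgetEdgeRelaxationStatements
open Summit.AtomisticToContinuum.Crystallization.Theorems.OverbindingBudgetElasticSplitStatements (surgeryGain LocallyOptimal LocalRelaxationTest)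
open Summit.AtomisticToContinuum.Crystallization.Theorems.OverbindingBudgetCubeTails
open Summit.AtomisticToContinuum.Crystallization.Theorems.OverbindingBudgetElasticSplitDilation (enum enum_injective interactionEnergy_enum)
open Summit.AtomisticToContinuum.Crystallization.Theorems.OverbindingBudgetLocalRelaxationCut

namespace Summit.AtomisticToContinuum.Crystallization.Theorems.OverbindingBudgetLocalRelaxation

/-- a uniformly discrete set meets a half-open cube in a finite set (`Q(c, ℓ) ⊆ B(c, 3ℓ)`; cf. `…ExcessInstability.finite_inter_cube`,
re-proved here to keep this module off the route-file cone). [folklore] -/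
theorem finite_inter_cube' {Y : Set (EuclideanSpace ℝ (Fin 3))} (hUD : UniformlyDiscrete Y) (c : (EuclideanSpace ℝ (Fin 3))) {ℓ : ℝ} (hℓ : 0 ≤ ℓ) :
    (Y ∩ {z | ∀ i : Fin 3, c i ≤ z i ∧ z i < c i + ℓ}).Finite := by
  refine (hUD.finite_inter_closedBall c (3 * ℓ)).subset ?_
  rintro z ⟨hzY, hz⟩
  refine ⟨hzY, ?_⟩
  rw [Metric.mem_closedBall, EuclideanSpace.dist_eq]
  have hi : ∀ i, dist (z i) (c i) ^ 2 ≤ ℓ ^ 2 := by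
    intro i
    rw [Real.dist_eq]
    have h := hz i
    have habs : |z i - c i| ≤ ℓ := by
      rw [abs_le]; constructor <;> linarith [h.1, h.2]
    nlinarith [abs_nonneg (z i - c i)]
  calc √(∑ i, dist (z i) (c i) ^ 2) ≤ √(∑ _i : Fin 3, ℓ ^ 2) :=
        Real.sqrt_le_sqrt (Finset.sum_le_sum (fun i _ => hi i))
    _ = √(3 * ℓ ^ 2) := by simp
    _ ≤ √((3 * ℓ) ^ 2) := Real.sqrt_le_sqrt (by nlinarith)
    _ = 3 * ℓ := Real.sqrt_sq (by linarith)

/-! ## §5  Geometry of the cell grid and the superposition theorem -/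

/-- cross interactions between two patches whose centres are `≥ 2(R+H)` apart are `≤ 16 · dist(p,q)⁻⁶` per pair. -/
theorem abs_lennardJones_cross {a b p q : (EuclideanSpace ℝ (Fin 3))} {R H : ℝ} (hR : 0 ≤ R) (hRH : R ≤ H) (h1H : 1 ≤ H) (ha : dist a p ≤ R)
    (hb : dist b q ≤ R) (hpq : 2 * (R + H) ≤ dist p q) : |lennardJones (dist a b)| ≤ 16 * (dist p q)⁻¹ ^ 6 := by
  have hab : dist p q - 2 * R ≤ dist a b := by
    have := dist_triangle4 p a b q
    rw [dist_comm p a] at this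
    linarith
  have hab2 : dist p q / 2 ≤ dist a b := by linarith
  have hab1 : 1 ≤ dist a b := by linarith
  have h1 := abs_lennardJones_le hab1
  have hpos : 0 < dist p q / 2 := by linarith
  have hinv : (dist a b)⁻¹ ≤ 2 * (dist p q)⁻¹ := by
    have := inv_anti₀ hpos hab2
    rwa [inv_div, div_eq_mul_inv] at this
  have h6 : (dist a b)⁻¹ ^ 6 ≤ (2 * (dist p q)⁻¹) ^ 6 := pow_le_pow_left₀ (inv_nonneg.2 dist_nonneg) hinv 6
  have : (2 * (dist p q)⁻¹) ^ 6 = 64 * (dist p q)⁻¹ ^ 6 := by ring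
  linarith

/-- a row of cross interactions into a patch of `≤ M₀` atoms. -/
theorem row_le {a p₀ q : (EuclideanSpace ℝ (Fin 3))} {B : Finset (EuclideanSpace ℝ (Fin 3))} {R H M₀ : ℝ} (hR : 0 ≤ R) (hRH : R ≤ H) (h1H : 1 ≤ H) (ha : dist a p₀ ≤ R)
    (hB : ∀ b ∈ B, dist b q ≤ R) (hpq : 2 * (R + H) ≤ dist p₀ q) (hM : (B.card : ℝ) ≤ M₀) :
    ∑ b ∈ B, |lennardJones (dist a b)| ≤ 16 * M₀ * (dist p₀ q)⁻¹ ^ 6 := by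
  have h := Finset.sum_le_sum fun b hb => abs_lennardJones_cross hR hRH h1H ha (hB b hb) hpq
  rw [Finset.sum_const, nsmul_eq_mul] at h
  have h0 : 0 ≤ 16 * (dist p₀ q)⁻¹ ^ 6 := by positivity
  nlinarith [mul_le_mul_of_nonneg_right hM h0]

set_option maxHeartbeats 800000 in
/-- **Piece B holds: dense improving surgeries strain the cubes.**  With `δ`-separation, gain `g`, radius `R`, density `G`: packing bound
`M₀ = (2(2R+1)/δ + 1)³` per patch; buffer `H = max(R, 1, 2K/g)` with `K = 864 M₀ (δ⁻⁶+1) δ⁻³ + 216 M₀²`; cell side `D = 2(G+R+H)`;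
`κ = g / (2 D³)`.  In the cube `[0, nD)³` the `n³` cell-centred patches are disjoint, `≥ 2(R+H)` apart and `≥ H` from the exterior, so by
`superpose_estimate` (tails `≤ 432(δ⁻⁶+1)δ⁻³ H⁻³`, cross rows `≤ 16 M₀ d⁻⁶` summed dyadically to `≤ 16·432 M₀ (2(R+H))⁻⁶`) the surgered
configuration certifies `E(#F) + n³ g/2 ≤ U(F)`. [this file] -/
theorem surgerySuperposition_holds : SurgerySuperposition := by
  intro Y hUD hDI
  obtain ⟨δ₀, hδ₀, hsep₀⟩ := id hUD
  set δ : ℝ := min δ₀ 1 with hδdef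
  have hδ : 0 < δ := lt_min hδ₀ one_pos
  have hδ1 : δ ≤ 1 := min_le_right _ _
  have hsep : ∀ x ∈ Y, ∀ y ∈ Y, x ≠ y → δ ≤ dist x y := fun x hx y hy hxy => (min_le_left _ _).trans (hsep₀ x hx y hy hxy)
  obtain ⟨g, hg, R, hR, G, hG, hdense⟩ := hDI
  choose p hpG hpatch using hdense
  simp only [ImprovingPatch] at hpatch
  choose F' G' hF'Y hF'R hG'R hcard hdisj hgain using hpatch
  -- packing bound per patch
  set M₀ : ℝ := (2 * (2 * R + 1) / δ + 1) ^ 3 with hM₀def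
  have hM₀0 : 0 ≤ M₀ := by positivity
  have hM₀F : ∀ z, ((F' z).card : ℝ) ≤ M₀ := by
    intro z
    have h := card_le_of_separated_of_box (F' z) (fun i => p z i - R - 1 / 2) (fun _ => 2 * R + 1) hδ (fun _ => by linarith)
      (fun y hy i => by
        have := (PiLp.dist_apply_le y (p z) i).trans (hF'R z y hy)
        rw [Real.dist_eq, abs_le] at this
        constructor <;> linarith [this.1, this.2])
      (fun y hy w hw hyw => hsep y (hF'Y z (Finset.mem_coe.2 hy)) w (hF'Y z (Finset.mem_coe.2 hw)) hyw)
    rw [Finset.prod_const, Finset.card_univ, Fintype.card_fin] at h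
    exact h
  have hM₀G : ∀ z, ((G' z).card : ℝ) ≤ M₀ := fun z => by rw [hcard z]; exact hM₀F z
  -- constants
  set γc : ℝ := 432 * (δ⁻¹ ^ 6 + 1) * δ⁻¹ ^ 3 with hγcdef
  have hγc : 0 ≤ γc := by positivity
  set H : ℝ := max (max R 1) (2 * (2 * M₀ * γc + 216 * M₀ ^ 2) / g) with hHdef
  have hRH : R ≤ H := (le_max_left R 1).trans (le_max_left _ _)
  have h1H : 1 ≤ H := (le_max_right R 1).trans (le_max_left _ _)
  have hKH : 2 * (2 * M₀ * γc + 216 * M₀ ^ 2) / g ≤ H := le_max_right _ _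
  have hH : 0 < H := by linarith
  set D : ℝ := 2 * (G + R + H) with hDdef
  have hD : 0 < D := by positivity
  refine ⟨g / (2 * D ^ 3), by positivity, ?_⟩
  intro ℓ₀
  set n : ℕ := ⌈ℓ₀ / D⌉₊ + 1 with hndef
  set ℓ : ℝ := n * D with hℓdef
  have hnR : (⌈ℓ₀ / D⌉₊ : ℝ) + 1 = n := by simp [hndef]
  have hℓ₀ : ℓ₀ ≤ ℓ := by
    have h1 : ℓ₀ / D ≤ ⌈ℓ₀ / D⌉₊ := Nat.le_ceil _
    have h2 : ℓ₀ / D ≤ n := by linarith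
    rw [div_le_iff₀ hD] at h2
    exact h2
  have hℓ0 : 0 ≤ ℓ := by positivity
  set c₀ : (EuclideanSpace ℝ (Fin 3)) := WithLp.toLp 2 (fun _ : Fin 3 => (0 : ℝ)) with hc₀def
  have hc₀ : ∀ i, c₀ i = 0 := fun i => by simp [hc₀def]
  refine ⟨ℓ, hℓ₀, c₀, ?_⟩
  set Cset : Set (EuclideanSpace ℝ (Fin 3)) := {z : (EuclideanSpace ℝ (Fin 3)) | ∀ i : Fin 3, c₀ i ≤ z i ∧ z i < c₀ i + ℓ} with hCsetdef
  have hfin : (Y ∩ Cset).Finite := finite_inter_cube' hUD c₀ hℓ0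
  set F : Finset (EuclideanSpace ℝ (Fin 3)) := hfin.toFinset with hFdef
  have hFset : (↑F : Set (EuclideanSpace ℝ (Fin 3))) = Y ∩ Cset := hfin.coe_toFinset
  have hFY : (↑F : Set (EuclideanSpace ℝ (Fin 3))) ⊆ Y := hFset ▸ Set.inter_subset_left
  refine ⟨F, hFset, ?_⟩
  -- the cells: centres `zc k`, patches `F' (zc k)`, `G' (zc k)` about `p (zc k)`
  set zc : (Fin 3 → Fin n) → (EuclideanSpace ℝ (Fin 3)) := fun k => WithLp.toLp 2 (fun i : Fin 3 => D * (((k i : ℕ) : ℝ) + 1 / 2)) with hzcdef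
  have hzci : ∀ k i, zc k i = D * (((k i : ℕ) : ℝ) + 1 / 2) := fun k i => by simp [hzcdef]
  -- (f1) coordinates of patch points
  have hco : ∀ (k : Fin 3 → Fin n) (a : (EuclideanSpace ℝ (Fin 3))), dist a (p (zc k)) ≤ R →
      ∀ i, D * ((k i : ℕ) : ℝ) + H ≤ a i ∧ a i ≤ D * (((k i : ℕ) : ℝ) + 1) - H := by
    intro k a ha i
    have h1 : dist a (zc k) ≤ R + G := (dist_triangle a (p (zc k)) (zc k)).trans (add_le_add ha (hpG (zc k)))
    have h2 := (PiLp.dist_apply_le a (zc k) i).trans h1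
    rw [hzci, Real.dist_eq, abs_le] at h2
    constructor <;> linarith [h2.1, h2.2]
  have hkn : ∀ (k : Fin 3 → Fin n) (i : Fin 3), ((k i : ℕ) : ℝ) + 1 ≤ n := fun k i => by exact_mod_cast (k i).isLt
  -- (f2) patch points lie in the cube
  have hmemC : ∀ (k : Fin 3 → Fin n) (a : (EuclideanSpace ℝ (Fin 3))), dist a (p (zc k)) ≤ R → a ∈ Cset := by
    intro k a ha i
    rw [hc₀]
    have h := hco k a ha i
    have h0 : 0 ≤ D * ((k i : ℕ) : ℝ) := by positivity
    have h3 : D * (((k i : ℕ) : ℝ) + 1) ≤ D * n := mul_le_mul_of_nonneg_left (hkn k i) hD.le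
    constructor <;> linarith [h.1, h.2]
  -- (f3) exterior atoms are `≥ H` away from patch points
  have hext : ∀ (k : Fin 3 → Fin n) (a : (EuclideanSpace ℝ (Fin 3))), dist a (p (zc k)) ≤ R → ∀ w ∈ Y \ (↑F : Set (EuclideanSpace ℝ (Fin 3))), H ≤ dist a w := by
    intro k a ha w hw
    have hwC : w ∉ Cset := fun h => hw.2 (by rw [hFset]; exact ⟨hw.1, h⟩)
    simp only [hCsetdef, Set.mem_setOf_eq, not_forall, not_and, not_lt] at hwC
    obtain ⟨i, hi⟩ := hwC
    have h := hco k a ha i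
    have h0 : 0 ≤ D * ((k i : ℕ) : ℝ) := by positivity
    have h3 : D * (((k i : ℕ) : ℝ) + 1) ≤ D * n := mul_le_mul_of_nonneg_left (hkn k i) hD.le
    refine le_trans ?_ (PiLp.dist_apply_le a w i)
    rw [Real.dist_eq]
    rw [hc₀] at hi
    by_cases hwi : 0 ≤ w i
    · have := hi hwi
      rw [abs_sub_comm]
      refine le_trans ?_ (le_abs_self _)
      linarith [h.2]
    · rw [not_le] at hwi
      refine le_trans ?_ (le_abs_self _)
      linarith [h.1]
  -- (f4) distinct cells have centres `≥ D` apart, patch centres `≥ 2(R+H)` apart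
  have hsepc : ∀ k l : Fin 3 → Fin n, k ≠ l → 2 * (R + H) ≤ dist (p (zc k)) (p (zc l)) := by
    intro k l hkl
    obtain ⟨i, hi⟩ := Function.ne_iff.1 hkl
    have hi' : (k i : ℕ) ≠ (l i : ℕ) := Fin.val_ne_of_ne hi
    have hzi : D ≤ |zc k i - zc l i| := by
      rw [hzci, hzci]
      rcases Nat.lt_or_gt_of_ne hi' with hlt | hlt
      · have : ((k i : ℕ) : ℝ) + 1 ≤ ((l i : ℕ) : ℝ) := by exact_mod_cast hlt
        rw [abs_sub_comm, abs_of_nonneg (by nlinarith)]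
        nlinarith
      · have : ((l i : ℕ) : ℝ) + 1 ≤ ((k i : ℕ) : ℝ) := by exact_mod_cast hlt
        rw [abs_of_nonneg (by nlinarith)]
        nlinarith
    have hz : D ≤ dist (zc k) (zc l) := le_trans (by rw [← Real.dist_eq] at hzi; exact hzi) (PiLp.dist_apply_le (zc k) (zc l) i)
    have t := dist_triangle4 (zc k) (p (zc k)) (p (zc l)) (zc l)
    rw [dist_comm (zc k) (p (zc k))] at t
    linarith [hpG (zc k), hpG (zc l)]
  -- (f5) exterior tails
  have htail : ∀ (k : Fin 3 → Fin n) (a : (EuclideanSpace ℝ (Fin 3))), dist a (p (zc k)) ≤ R →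
      |∑' w : ↥(Y \ (↑F : Set (EuclideanSpace ℝ (Fin 3)))), lennardJones (dist a (w : (EuclideanSpace ℝ (Fin 3))))| ≤ γc * H⁻¹ ^ 3 := by
    intro k a ha
    exact abs_tsum_lennardJones_le_dyadic a hδ (hδ1.trans h1H) (fun w hw => hext k a ha w hw)
      (fun w hw w' hw' hne => hsep w hw.1 w' hw'.1 hne)
  -- (f6) the dyadic sum of the cross rows
  have hcross : ∀ k : Fin 3 → Fin n,
      ∑ l ∈ Finset.univ.erase k, 16 * M₀ * (dist (p (zc k)) (p (zc l)))⁻¹ ^ 6 ≤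
        16 * M₀ * (432 * (2 * (R + H))⁻¹ ^ 3 * (2 * (R + H))⁻¹ ^ 3) := by
    intro k
    rw [← Finset.mul_sum]
    refine mul_le_mul_of_nonneg_left ?_ (by positivity)
    have hinj : ∀ l ∈ Finset.univ.erase k, ∀ l' ∈ Finset.univ.erase k, p (zc l) = p (zc l') → l = l' := by
      intro l _ l' _ hll
      by_contra hne
      have := hsepc l l' hne
      rw [hll, dist_self] at this
      linarith
    have hsi : ∑ l ∈ Finset.univ.erase k, (dist (p (zc k)) (p (zc l)))⁻¹ ^ 6 =
        ∑ q ∈ (Finset.univ.erase k).image (fun l => p (zc l)), (dist (p (zc k)) q)⁻¹ ^ 6 := by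
      rw [Finset.sum_image hinj]
    rw [hsi]
    refine sum_inv_pow_six_le_dyadic _ (p (zc k)) (by positivity : (0 : ℝ) < 2 * (R + H)) le_rfl ?_ ?_
    · intro q hq
      obtain ⟨l, hl, rfl⟩ := Finset.mem_image.1 hq
      exact hsepc k l (Finset.ne_of_mem_erase hl).symm
    · intro q hq q' hq' hne
      obtain ⟨l, hl, rfl⟩ := Finset.mem_image.1 hq
      obtain ⟨l', hl', rfl⟩ := Finset.mem_image.1 hq'
      exact hsepc l l' fun h => hne (by rw [h])
  -- (f7) the error budget per cell
  have herr : M₀ * (2 * (γc * H⁻¹ ^ 3) + 2 * (16 * M₀ * (432 * (2 * (R + H))⁻¹ ^ 3 * (2 * (R + H))⁻¹ ^ 3))) ≤ g / 2 := by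
    have hu0 : 0 ≤ H⁻¹ := inv_nonneg.2 hH.le
    have hu1 : H⁻¹ ≤ 1 := inv_le_one_of_one_le₀ h1H
    have hD'inv : (2 * (R + H))⁻¹ ≤ H⁻¹ / 2 := by
      have h := inv_anti₀ (by positivity : (0 : ℝ) < 2 * H) (by linarith : 2 * H ≤ 2 * (R + H))
      have e : (2 * H)⁻¹ = H⁻¹ / 2 := by rw [mul_inv]; ring
      linarith [e]
    have hD'0 : 0 ≤ (2 * (R + H))⁻¹ := by positivity
    have hP : (2 * (R + H))⁻¹ ^ 3 * (2 * (R + H))⁻¹ ^ 3 ≤ H⁻¹ ^ 3 / 64 := by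
      have h6 : (2 * (R + H))⁻¹ ^ 6 ≤ (H⁻¹ / 2) ^ 6 := pow_le_pow_left₀ hD'0 hD'inv 6
      have h63 : H⁻¹ ^ 6 ≤ H⁻¹ ^ 3 := pow_le_pow_of_le_one hu0 hu1 (by norm_num)
      have e : (2 * (R + H))⁻¹ ^ 3 * (2 * (R + H))⁻¹ ^ 3 = (2 * (R + H))⁻¹ ^ 6 := by ring
      have e2 : (H⁻¹ / 2) ^ 6 = H⁻¹ ^ 6 / 64 := by ring
      rw [e]; linarith
    have hu3 : H⁻¹ ^ 3 ≤ H⁻¹ := by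
      have := pow_le_pow_of_le_one hu0 hu1 (by norm_num : 1 ≤ 3)
      rwa [pow_one] at this
    have hKu : (2 * M₀ * γc + 216 * M₀ ^ 2) * H⁻¹ ≤ g / 2 := by
      rw [← div_eq_mul_inv, div_le_iff₀ hH]
      rw [div_le_iff₀ hg] at hKH
      linarith
    have h2 : M₀ * M₀ * ((2 * (R + H))⁻¹ ^ 3 * (2 * (R + H))⁻¹ ^ 3) ≤ M₀ * M₀ * (H⁻¹ ^ 3 / 64) :=
      mul_le_mul_of_nonneg_left hP (by positivity)
    have h3 : (2 * M₀ * γc + 216 * M₀ ^ 2) * H⁻¹ ^ 3 ≤ (2 * M₀ * γc + 216 * M₀ ^ 2) * H⁻¹ :=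
      mul_le_mul_of_nonneg_left hu3 (by positivity)
    linarith [h2, h3, hKu]
  -- (f8) the abstract estimate on the grid
  have hest := superpose_estimate hUD (Finset.univ : Finset (Fin 3 → Fin n)) F hFY (fun k => F' (zc k)) (fun k => G' (zc k))
    (fun k _ y hy => by
      rw [← Finset.mem_coe, hFset]
      exact ⟨hF'Y (zc k) (Finset.mem_coe.2 hy), hmemC k y (hF'R (zc k) y hy)⟩)
    (fun k _ l _ hkl => by
      rw [Function.onFun, Finset.disjoint_left]
      intro y hyk hyl
      have t := dist_triangle (p (zc k)) y (p (zc l))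
      rw [dist_comm (p (zc k)) y] at t
      linarith [hF'R (zc k) y hyk, hF'R (zc l) y hyl, hsepc k l hkl])
    (fun k _ l _ hkl => by
      rw [Function.onFun, Finset.disjoint_left]
      intro y hyk hyl
      have t := dist_triangle (p (zc k)) y (p (zc l))
      rw [dist_comm (p (zc k)) y] at t
      linarith [hG'R (zc k) y hyk, hG'R (zc l) y hyl, hsepc k l hkl])
    (fun k _ => hdisj (zc k)) (fun k _ => hcard (zc k)) (γ := γc * H⁻¹ ^ 3) (M₀ := M₀)
    (β := fun k l => 16 * M₀ * (dist (p (zc k)) (p (zc l)))⁻¹ ^ 6) (by positivity) (fun k l => by positivity)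
    (fun k _ => hgain (zc k)) (fun k _ => hM₀F (zc k))
    (fun k _ a ha => htail k a (hF'R (zc k) a ha)) (fun k _ a ha => htail k a (hG'R (zc k) a ha))
    (fun k _ l _ hkl a ha => row_le hR.le hRH h1H (hF'R (zc k) a ha) (hF'R (zc l)) (hsepc k l hkl) (hM₀F (zc l)))
    (fun k _ l _ hkl a ha => row_le hR.le hRH h1H (hG'R (zc k) a ha) (hF'R (zc l)) (hsepc k l hkl) (hM₀F (zc l)))
    (fun k _ l _ hkl a ha => row_le hR.le hRH h1H (hG'R (zc k) a ha) (hG'R (zc l)) (hsepc k l hkl) (hM₀G (zc l)))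
    (fun k _ => (mul_le_mul_of_nonneg_left (by linarith [hcross k]) hM₀0).trans herr)
  -- (f9) `#cells · g/2 = κ ℓ³`
  have hcardι : ((Finset.univ : Finset (Fin 3 → Fin n)).card : ℝ) = (n : ℝ) ^ 3 := by
    rw [Finset.card_univ]; push_cast [Fintype.card_fun, Fintype.card_fin]; try ring
  have hκ : g / (2 * D ^ 3) * ℓ ^ 3 = (n : ℝ) ^ 3 * (g / 2) := by
    rw [hℓdef]; field_simp
  rw [hκ, ← hcardι]
  exact hest

/-! ## The abstract estimate, finite-gain form (used by part III) -/

/-- **abstract superposition estimate, finite-gain form**: as `superpose_estimate`, but each cell is entered through a lower bound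
`g − E` on its FINITE gain `U(F'_k) + I(F'_k, F ∖ F'_k) − U(G'_k) − I(G'_k, F ∖ F'_k)` inside `F`; with cross rows `≤ β k l` and
`E + 2 M₀ Σ_{l≠k} β k l ≤ g/2` one gets `E(#F) + #s · g/2 ≤ U(F)`. -/
theorem superpose_estimate_fin {ι : Type*} [DecidableEq ι] {Y : Set (EuclideanSpace ℝ (Fin 3))} (s : Finset ι)
    (F : Finset (EuclideanSpace ℝ (Fin 3))) (hFY : (↑F : Set (EuclideanSpace ℝ (Fin 3))) ⊆ Y)
    (F' G' : ι → Finset (EuclideanSpace ℝ (Fin 3))) (hF'F : ∀ k ∈ s, F' k ⊆ F) (hF : (↑s : Set ι).PairwiseDisjoint F')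
    (hG : (↑s : Set ι).PairwiseDisjoint G')
    (hGY : ∀ k ∈ s, Disjoint (↑(G' k) : Set (EuclideanSpace ℝ (Fin 3))) (Y \ ↑(F' k)))
    (hcard : ∀ k ∈ s, (G' k).card = (F' k).card) {g E M₀ : ℝ} {β : ι → ι → ℝ} (hβ : ∀ k l, 0 ≤ β k l)
    (hM : ∀ k ∈ s, ((F' k).card : ℝ) ≤ M₀)
    (hfin : ∀ k ∈ s, g - E ≤ selfEnergy (F' k) + pairSum (F' k) (F \ F' k) - selfEnergy (G' k) - pairSum (G' k) (F \ F' k))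
    (hβFF : ∀ k ∈ s, ∀ l ∈ s, k ≠ l → ∀ a ∈ F' k, ∑ b ∈ F' l, |lennardJones (dist a b)| ≤ β k l)
    (hβGF : ∀ k ∈ s, ∀ l ∈ s, k ≠ l → ∀ a ∈ G' k, ∑ b ∈ F' l, |lennardJones (dist a b)| ≤ β k l)
    (hβGG : ∀ k ∈ s, ∀ l ∈ s, k ≠ l → ∀ a ∈ G' k, ∑ b ∈ G' l, |lennardJones (dist a b)| ≤ β k l)
    (herr : ∀ k ∈ s, E + 2 * M₀ * ∑ l ∈ s.erase k, β k l ≤ g / 2) :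
    groundStateEnergy lennardJones 3 F.card + s.card * (g / 2) ≤ selfEnergy F := by
  set Rst : Finset (EuclideanSpace ℝ (Fin 3)) := F \ s.biUnion F' with hRst
  set X : Finset (EuclideanSpace ℝ (Fin 3)) := Rst ∪ s.biUnion G' with hX
  have hUF : s.biUnion F' ⊆ F := Finset.biUnion_subset.2 hF'F
  have hFdec : F = Rst ∪ s.biUnion F' := (Finset.sdiff_union_of_subset hUF).symm
  have hXcard : X.card = F.card := card_surgered s F hFY F' G' hF'F hF hG hGY hcard
  have hEX : groundStateEnergy lennardJones 3 F.card ≤ selfEnergy X := by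
    rw [← hXcard, selfEnergy, ← interactionEnergy_enum X]
    exact groundStateEnergy_lennardJones_le (enum_injective X)
  have hRF : ∀ k ∈ s, Disjoint Rst (F' k) := fun k hk =>
    Finset.disjoint_of_subset_right (Finset.subset_biUnion_of_mem F' hk) Finset.sdiff_disjoint
  have hRG : ∀ k ∈ s, Disjoint Rst (G' k) := by
    intro k hk
    rw [Finset.disjoint_left]
    intro x hx hxG
    rw [hRst, Finset.mem_sdiff] at hx
    have hxU : x ∉ F' k := fun h => hx.2 (Finset.mem_biUnion.2 ⟨k, hk, h⟩)
    exact Set.disjoint_left.1 (hGY k hk) (Finset.mem_coe.2 hxG) ⟨hFY (Finset.mem_coe.2 hx.1), fun h => hxU (Finset.mem_coe.1 h)⟩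
  have hident := selfEnergy_family_sub s Rst F' G' hF hG hRF hRG
  rw [← hFdec] at hident
  have hcell : ∀ k ∈ s, selfEnergy (F' k) + pairSum (F' k) Rst - selfEnergy (G' k) - pairSum (G' k) Rst =
      (selfEnergy (F' k) + pairSum (F' k) (F \ F' k) - selfEnergy (G' k) - pairSum (G' k) (F \ F' k)) -
        ∑ l ∈ s.erase k, pairSum (F' k) (F' l) + ∑ l ∈ s.erase k, pairSum (G' k) (F' l) := by
    intro k hk
    have hsd := sdiff_eq_rest_union s F F' hF'F hF hk
    have hdj : Disjoint Rst ((s.erase k).biUnion F') :=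
      (Finset.disjoint_biUnion_right _ _ _).2 fun l hl => hRF l (Finset.mem_of_mem_erase hl)
    have hFe : (↑(s.erase k) : Set ι).PairwiseDisjoint F' := hF.subset (Finset.coe_subset.2 (Finset.erase_subset k s))
    have e1 : pairSum (F' k) (F \ F' k) = pairSum (F' k) Rst + ∑ l ∈ s.erase k, pairSum (F' k) (F' l) := by
      rw [hsd, pairSum_union_right _ hdj, pairSum_biUnion_right _ _ F' hFe]
    have e2 : pairSum (G' k) (F \ F' k) = pairSum (G' k) Rst + ∑ l ∈ s.erase k, pairSum (G' k) (F' l) := by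
      rw [hsd, pairSum_union_right _ hdj, pairSum_biUnion_right _ _ F' hFe]
    rw [e1, e2]
    ring
  have hlow : ∀ k ∈ s, g / 2 ≤ (selfEnergy (F' k) + pairSum (F' k) Rst - selfEnergy (G' k) - pairSum (G' k) Rst) +
      1 / 2 * ∑ l ∈ s.erase k, (pairSum (F' k) (F' l) - pairSum (G' k) (G' l)) := by
    intro k hk
    rw [hcell k hk]
    have hMk := hM k hk
    have hMk' : ((G' k).card : ℝ) ≤ M₀ := by rw [hcard k hk]; exact hMk
    have cFF : ∀ l ∈ s.erase k, |pairSum (F' k) (F' l)| ≤ M₀ * β k l := fun l hl =>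
      (abs_pairSum_le (hβFF k hk l (Finset.mem_of_mem_erase hl) (Finset.ne_of_mem_erase hl).symm)).trans
        (mul_le_mul_of_nonneg_right hMk (hβ k l))
    have cGF : ∀ l ∈ s.erase k, |pairSum (G' k) (F' l)| ≤ M₀ * β k l := fun l hl =>
      (abs_pairSum_le (hβGF k hk l (Finset.mem_of_mem_erase hl) (Finset.ne_of_mem_erase hl).symm)).trans
        (mul_le_mul_of_nonneg_right hMk' (hβ k l))
    have cGG : ∀ l ∈ s.erase k, |pairSum (G' k) (G' l)| ≤ M₀ * β k l := fun l hl =>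
      (abs_pairSum_le (hβGG k hk l (Finset.mem_of_mem_erase hl) (Finset.ne_of_mem_erase hl).symm)).trans
        (mul_le_mul_of_nonneg_right hMk' (hβ k l))
    have sFF : |∑ l ∈ s.erase k, pairSum (F' k) (F' l)| ≤ M₀ * ∑ l ∈ s.erase k, β k l := by
      rw [Finset.mul_sum]; exact (Finset.abs_sum_le_sum_abs _ _).trans (Finset.sum_le_sum cFF)
    have sGF : |∑ l ∈ s.erase k, pairSum (G' k) (F' l)| ≤ M₀ * ∑ l ∈ s.erase k, β k l := by
      rw [Finset.mul_sum]; exact (Finset.abs_sum_le_sum_abs _ _).trans (Finset.sum_le_sum cGF)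
    have sGG : |∑ l ∈ s.erase k, pairSum (G' k) (G' l)| ≤ M₀ * ∑ l ∈ s.erase k, β k l := by
      rw [Finset.mul_sum]; exact (Finset.abs_sum_le_sum_abs _ _).trans (Finset.sum_le_sum cGG)
    have hg := hfin k hk
    have he := herr k hk
    rw [Finset.sum_sub_distrib]
    rw [abs_le] at sFF sGF sGG
    obtain ⟨s1, s2⟩ := sFF; obtain ⟨s3, s4⟩ := sGF; obtain ⟨s5, s6⟩ := sGG
    linarith
  have hsum : (s.card : ℝ) * (g / 2) ≤ selfEnergy F - selfEnergy X := by
    rw [hX, hident]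
    have := Finset.sum_le_sum hlow
    rw [Finset.sum_const, nsmul_eq_mul, Finset.sum_add_distrib, ← Finset.mul_sum] at this
    exact this
  linarith

/-- **LRT from the recurrence piece alone**: `ImprovementRecurrence T₀ D → LocalRelaxationTest T₀ D` (piece B is proved). -/
theorem localRelaxationTest_of_recurrence {T₀ D : ℝ} (hA : ImprovementRecurrence T₀ D) : LocalRelaxationTest T₀ D :=
  localRelaxationTest_of hA surgerySuperposition_holds

end Summit.AtomisticToContinuum.Crystallization.Theorems.OverbindingBudgetLocalRelaxation

end
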